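import Summits.RiemannHypothesis.RiemannHypothesis.Theorems.WeilFormatCWindowDictionary
import Summits.RiemannHypothesis.RiemannHypothesis.Theorems.WeilFormatCSectorSplit
import Summits.RiemannHypothesis.RiemannHypothesis.Theorems.MotivicDoorSemilocalMarkov
import HarnessLib

/-!
# Format C at `S = {∞, 2}`: the DICTIONARY for the semi-local form (`DictionaryTwo` of the cc-s2 instance)

Helper file (`--supports stmt-RiemannHypothesis-0098`, lead-track anchor), RH-free, no definitions, no named
facts. Seat rh-explicit-weil-3 (gen3). The full-Weil dictionary `weilPositivityOn_of_weilWindowForm_sum_chi_nonneg`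
(`WeilFormatCWindowDictionary.lean`) transposed to the `{∞,2}` semi-local form of the cc-s2 format-C instance
(cc-s2-4's `S2FormatCEnclosure.lean` names the statement `DictionaryTwo b`; cc-s2-2 / weil-3 own it):

the `{∞,2}` WINDOW FORM of a function `u` on `[−b, b]` is
`F₂(u) = P(u) + (log 2/√2)·D_{log 2}(u) + ∫₀^∞ weilArchDensity(t)·D_t(u) dt − C₂·‖u‖₂²`
(`P = weilPoleForm`, `D_t = weilIncrement`, `C₂ = MotivicDoor.SemilocalMarkov.semilocalTwoConstant`); by the tree's
`MotivicDoor.SemilocalMarkov.re_weilSemilocalQuadratic_two_eq` it equals `Re Q_{{2}}(g)` on test functions supported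
in `[−b, b]`, `b ≤ log 2`, and weil-2's `semilocalTwoWindowForm_sum_smul_chi` (`WeilFormatCEntry.lean`) computes it in
closed form on the trigonometric windows `Σ c_n χ_n` (`log 2 ≤ 2b`).

* `exists_uniform_family_proj`: the truncated Fourier series `proj b N φ` of `φ ∈ K(b)` form a uniformly convergent,
  `N`-uniformly bounded and Lipschitz window family (the hypotheses of `tendsto_weilWindowForm_of_uniform`, packaged);
* `tendsto_archIntegral_of_uniform`: the archimedean energy `∫₀^∞ weilArchDensity·D_t(u_N)` converges along such
  families (dominated convergence with the bound `archBound` of `WeilFormatCWindowLimit.lean`);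
* `tendsto_semilocalTwoWindow_of_uniform`, `tendsto_semilocalTwoWindow_proj`: continuity of `F₂` along them;
* **`weilSemilocalPositivityOn_two_of_window_sum_chi_nonneg`** (THE `S = {2}` DICTIONARY): `0 < b ≤ log 2` and
  `0 ≤ F₂(Σ_{|n|≤N} c_n χ_n)` for all `N`, `c` ⟹ `WeilSemilocalPositivityOn {2} b`;
* `weilSemilocalPositivityOn_two_of_sector_psd`: the same from a real kernel `G` with `F₂(Σ c_nχ_n) =
  Σ Re(conj c_n c_m) G(n,m)` (the entry theorem, hypothesis), `G(−n,−m) = G(n,m)`, and the two real sector kernels of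
  weil-2's `sum_modes_re_conj_mul_nonneg_of_sectors` PSD on every truncation.
-/

set_option autoImplicit false
set_option linter.dupNamespace false  -- the mandated namespace repeats `RiemannHypothesis`

noncomputable section

open Complex Filter Set MeasureTheory
open scoped Real Topology ComplexConjugate

namespace Summit.RiemannHypothesis.RiemannHypothesis.Theorems.WeilFormatC

open Literature.NumberTheory.LFunctions
open Literature.NumberTheory.LFunctions.Yoshida1992 (modes chi proj trigPoly
  proj_apply_of_mem proj_apply_of_not_mem proj_apply_eq_indicator_trigPoly norm_trigPoly_le
  norm_sub_trigPoly_le norm_trigPoly_sub_le norm_trigPolyDeriv_le tendsto_tsum_compl_modes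
  summable_pow_mul_norm_fourierCoeff C_le_K)
open Summit.RiemannHypothesis.RiemannHypothesis.Theorems.MotivicDoor.SemilocalMarkov (semilocalTwoConstant
  re_weilSemilocalQuadratic_two_eq)

variable {a : ℝ} {φ : ℝ → ℂ} {u : ℕ → ℝ → ℂ} {S₀ S₁ : ℝ} {δ : ℕ → ℝ}

/-! ## The truncated Fourier series as a uniform window family -/

/-- **The truncated Fourier series of `φ ∈ K(a)` form a uniform window family** (`a > 0`): measurable, vanishing
off `[−a, a]`, `N`-uniformly bounded and Lipschitz on the window, and uniformly convergent to `φ`. -/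
theorem exists_uniform_family_proj (ha : 0 < a) (hφ : φ ∈ Yoshida1992.K a) :
    ∃ (S₀ S₁ : ℝ) (δ : ℕ → ℝ), (∀ N, Measurable (proj a N φ)) ∧
      (∀ N x, x ∉ Icc (-a) a → proj a N φ x = 0) ∧ (∀ N x, ‖proj a N φ x‖ ≤ S₀) ∧
      (∀ N x y, x ∈ Icc (-a) a → y ∈ Icc (-a) a → ‖proj a N φ y - proj a N φ x‖ ≤ S₁ * |y - x|) ∧
      (∀ N x, ‖proj a N φ x - φ x‖ ≤ δ N) ∧ Tendsto δ atTop (𝓝 0) := by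
  have hsum0 : Summable fun n : ℤ ↦ ‖Yoshida1992.fourierCoeff a n φ‖ := by
    simpa using summable_pow_mul_norm_fourierCoeff ha hφ 0
  have hsum1 := summable_pow_mul_norm_fourierCoeff ha hφ 1
  have hcont : ∀ N, Continuous (trigPoly a N φ) := fun N ↦
    continuous_finsetSum _ fun n _ ↦ continuous_const.mul
      (Complex.continuous_exp.comp ((continuous_const.mul Complex.continuous_ofReal).div_const _))
  refine ⟨∑' n : ℤ, ‖Yoshida1992.fourierCoeff a n φ‖ / (2 * a),
    (π / a / (2 * a)) * ∑' n : ℤ, |(n : ℝ)| ^ 1 * ‖Yoshida1992.fourierCoeff a n φ‖,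
    fun N ↦ ∑' n : {n // n ∉ modes N}, ‖Yoshida1992.fourierCoeff a n φ‖ / (2 * a),
    fun N ↦ ?_, fun N x hx ↦ proj_apply_of_not_mem ha N φ hx, fun N x ↦ ?_, fun N x y hx hy ↦ ?_,
    fun N x ↦ ?_, tendsto_tsum_compl_modes a φ⟩
  · have : proj a N φ = (Icc (-a) a).indicator (trigPoly a N φ) :=
      funext fun x ↦ proj_apply_eq_indicator_trigPoly ha N φ x
    rw [this]
    exact (hcont N).measurable.indicator measurableSet_Icc
  · by_cases hx : x ∈ Icc (-a) a
    · rw [proj_apply_of_mem ha N φ hx]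
      exact norm_trigPoly_le ha hsum0 N x
    · rw [proj_apply_of_not_mem ha N φ hx, norm_zero]
      exact tsum_nonneg fun n ↦ by positivity
  · rw [proj_apply_of_mem ha N φ hx, proj_apply_of_mem ha N φ hy]
    exact norm_trigPoly_sub_le (fun z ↦ norm_trigPolyDeriv_le ha hsum1 N z) x y
  · by_cases hx : x ∈ Icc (-a) a
    · rw [proj_apply_of_mem ha N φ hx, norm_sub_rev]
      exact norm_sub_trigPoly_le ha hφ N hx
    · rw [proj_apply_of_not_mem ha N φ hx,
        Yoshida1992.eq_zero_of_mem_K hφ (lt_abs_of_not_mem_Icc_window hx), sub_zero, norm_zero]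
      exact tsum_nonneg fun n ↦ by positivity

/-! ## Continuity of the archimedean energy and of the `{∞,2}` window form -/

/-- **The archimedean energy is continuous along uniform window families**:
`∫₀^∞ weilArchDensity(t)·D_t(u_N) dt → ∫₀^∞ weilArchDensity(t)·D_t(φ) dt` (dominated convergence with the
`N`-uniform majorant `archBound`). -/
theorem tendsto_archIntegral_of_uniform (ha : 0 < a) (hum : ∀ N, Measurable (u N))
    (huz : ∀ N x, x ∉ Icc (-a) a → u N x = 0) (hub : ∀ N x, ‖u N x‖ ≤ S₀)
    (hul : ∀ N x y, x ∈ Icc (-a) a → y ∈ Icc (-a) a → ‖u N y - u N x‖ ≤ S₁ * |y - x|)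
    (hnear : ∀ N x, ‖u N x - φ x‖ ≤ δ N) (hδ : Tendsto δ atTop (𝓝 0)) :
    Tendsto (fun N ↦ ∫ t in Ioi (0 : ℝ), weilArchDensity t * weilIncrement (u N) t) atTop
      (𝓝 (∫ t in Ioi (0 : ℝ), weilArchDensity t * weilIncrement φ t)) := by
  have hinc : ∀ t, Tendsto (fun N ↦ weilIncrement (u N) t) atTop (𝓝 (weilIncrement φ t)) :=
    tendsto_weilIncrement_of_uniform hum huz hub hnear hδ
  refine tendsto_integral_of_dominated_convergence
    (fun t ↦ weilArchDensity t * (if t ≤ 1 then (2 * a * S₁ ^ 2 + 2 * S₀ ^ 2) * t else 8 * a * S₀ ^ 2))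
    (fun N ↦ (measurable_weilArchDensity.mul (measurable_weilIncrement (hum N))).aestronglyMeasurable)
    (integrableOn_archBound ha.le S₀ S₁) (fun N ↦ ?_)
    (Eventually.of_forall fun t ↦ (hinc t).const_mul _)
  refine (ae_restrict_iff' measurableSet_Ioi).2 (Eventually.of_forall fun t ht ↦ ?_)
  rw [Real.norm_of_nonneg (mul_nonneg (weilArchDensity_pos ht).le (weilIncrement_nonneg _ _))]
  exact weilArchDensity_mul_weilIncrement_le_archBound ha.le (hum N) (huz N) (hub N) (hul N) ht

/-- **The `{∞,2}` window form is continuous along uniform window families.** -/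
theorem tendsto_semilocalTwoWindow_of_uniform (ha : 0 < a) (hum : ∀ N, Measurable (u N))
    (huz : ∀ N x, x ∉ Icc (-a) a → u N x = 0) (hub : ∀ N x, ‖u N x‖ ≤ S₀)
    (hul : ∀ N x y, x ∈ Icc (-a) a → y ∈ Icc (-a) a → ‖u N y - u N x‖ ≤ S₁ * |y - x|)
    (hnear : ∀ N x, ‖u N x - φ x‖ ≤ δ N) (hδ : Tendsto δ atTop (𝓝 0)) :
    Tendsto (fun N ↦ weilPoleForm (u N) + Real.log 2 / Real.sqrt 2 * weilIncrement (u N) (Real.log 2) +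
        (∫ t in Ioi (0 : ℝ), weilArchDensity t * weilIncrement (u N) t) -
        semilocalTwoConstant * ∫ x : ℝ, ‖u N x‖ ^ 2) atTop
      (𝓝 (weilPoleForm φ + Real.log 2 / Real.sqrt 2 * weilIncrement φ (Real.log 2) +
        (∫ t in Ioi (0 : ℝ), weilArchDensity t * weilIncrement φ t) -
        semilocalTwoConstant * ∫ x : ℝ, ‖φ x‖ ^ 2)) :=
  (((tendsto_weilPoleForm_of_uniform hum huz hub hnear hδ).add
    ((tendsto_weilIncrement_of_uniform hum huz hub hnear hδ _).const_mul _)).add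
    (tendsto_archIntegral_of_uniform ha hum huz hub hul hnear hδ)).sub
    ((tendsto_integral_norm_sq_of_uniform hum huz hub hnear hδ).const_mul _)

/-- **The `{∞,2}` window form is continuous along the truncated Fourier series** of `φ ∈ K(b)` (`b > 0`). -/
theorem tendsto_semilocalTwoWindow_proj {b : ℝ} (hb : 0 < b) (hφ : φ ∈ Yoshida1992.K b) :
    Tendsto (fun N ↦ weilPoleForm (proj b N φ) +
        Real.log 2 / Real.sqrt 2 * weilIncrement (proj b N φ) (Real.log 2) +
        (∫ t in Ioi (0 : ℝ), weilArchDensity t * weilIncrement (proj b N φ) t) -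
        semilocalTwoConstant * ∫ x : ℝ, ‖proj b N φ x‖ ^ 2) atTop
      (𝓝 (weilPoleForm φ + Real.log 2 / Real.sqrt 2 * weilIncrement φ (Real.log 2) +
        (∫ t in Ioi (0 : ℝ), weilArchDensity t * weilIncrement φ t) -
        semilocalTwoConstant * ∫ x : ℝ, ‖φ x‖ ^ 2)) := by
  obtain ⟨S₀, S₁, δ, hum, huz, hub, hul, hnear, hδ⟩ := exists_uniform_family_proj hb hφ
  exact tendsto_semilocalTwoWindow_of_uniform (u := fun N ↦ proj b N φ) hb hum huz hub hul hnear hδ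

/-! ## The `S = {2}` dictionary -/

/-- **THE `S = {2}` DICTIONARY** (`DictionaryTwo`). Let `0 < b ≤ log 2`. If the `{∞,2}` window form is
non-negative on every trigonometric window of `[−b, b]`,
`0 ≤ P(u) + (log 2/√2)·D_{log 2}(u) + ∫₀^∞ weilArchDensity·D_t(u) − C₂‖u‖₂²` for `u = Σ_{|n|≤N} c_n χ_n`, all `N`,
all `c : ℤ → ℂ`, then the semi-local Weil form at the places `{∞, 2}` is non-negative on every test function
supported in `[−b, b]`: `WeilSemilocalPositivityOn {2} b`. (Truncated Fourier series of `g ∈ C(b) ⊆ K(b)` are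
trigonometric windows with `c_n = (2b)^{−1/2} ĝ_n`; pass to the limit; identify the limit with `Re Q_{{2}}(g)` by
`re_weilSemilocalQuadratic_two_eq`.) -/
theorem weilSemilocalPositivityOn_two_of_window_sum_chi_nonneg {b : ℝ} (hb : 0 < b) (hb2 : b ≤ Real.log 2)
    (h : ∀ (N : ℕ) (c : ℤ → ℂ),
      0 ≤ weilPoleForm (∑ n ∈ modes N, c n • chi b n) +
        Real.log 2 / Real.sqrt 2 * weilIncrement (∑ n ∈ modes N, c n • chi b n) (Real.log 2) +
        (∫ t in Ioi (0 : ℝ), weilArchDensity t * weilIncrement (∑ n ∈ modes N, c n • chi b n) t) -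
        semilocalTwoConstant * ∫ x : ℝ, ‖(∑ n ∈ modes N, c n • chi b n) x‖ ^ 2) :
    WeilSemilocalPositivityOn {2} b := by
  intro g hg hsupp
  rw [re_weilSemilocalQuadratic_two_eq hg hsupp hb2]
  have hK : g ∈ Yoshida1992.K b := C_le_K hb ⟨hg, hsupp⟩
  exact ge_of_tendsto' (tendsto_semilocalTwoWindow_proj hb hK) fun N ↦
    h N fun n ↦ (((1 / Real.sqrt (2 * b) : ℝ) : ℂ) * Yoshida1992.fourierCoeff b n g)

/-- **The `S = {2}` dictionary, sector form.** Let `0 < b ≤ log 2` and let `G : ℤ → ℤ → ℝ` be a real kernel with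
the ENTRY IDENTITY `F₂(Σ_{|n|≤N} c_n χ_n) = Σ_{n,m} Re(conj c_n · c_m)·G(n,m)` (weil-2's `semilocalTwoWindowForm_sum_smul_chi`
/ cc-s2-4's `EntryTheoremTwo`, supplied as a hypothesis) and the reflection symmetry `G(−n,−m) = G(n,m)`. If the even
sector kernel `M⁺(0,m) = G(0,m)`, `M⁺(n,0) = G(n,0)`, `M⁺(n,m) = (G(n,m)+G(n,−m))/2` on `range (N+1)` and the odd one
`M⁻(k,l) = (G(k+1,l+1) − G(k+1,−(l+1)))/2` on `range N` are non-negative real quadratic forms for every `N`, then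
`WeilSemilocalPositivityOn {2} b`. -/
theorem weilSemilocalPositivityOn_two_of_sector_psd {b : ℝ} (hb : 0 < b) (hb2 : b ≤ Real.log 2)
    (G : ℤ → ℤ → ℝ)
    (hG : ∀ (N : ℕ) (c : ℤ → ℂ),
      weilPoleForm (∑ n ∈ modes N, c n • chi b n) +
        Real.log 2 / Real.sqrt 2 * weilIncrement (∑ n ∈ modes N, c n • chi b n) (Real.log 2) +
        (∫ t in Ioi (0 : ℝ), weilArchDensity t * weilIncrement (∑ n ∈ modes N, c n • chi b n) t) -
        semilocalTwoConstant * ∫ x : ℝ, ‖(∑ n ∈ modes N, c n • chi b n) x‖ ^ 2 =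
      ∑ n ∈ modes N, ∑ m ∈ modes N, (conj (c n) * c m).re * G n m)
    (hrefl : ∀ n m, G (-n) (-m) = G n m)
    (hev : ∀ (N : ℕ) (y : ℕ → ℝ), 0 ≤ ∑ n ∈ Finset.range (N + 1), ∑ m ∈ Finset.range (N + 1),
      y n * y m * (if n = 0 then G 0 m else if m = 0 then G n 0 else (G n m + G n (-(m : ℤ))) / 2))
    (hod : ∀ (N : ℕ) (z : ℕ → ℝ), 0 ≤ ∑ k ∈ Finset.range N, ∑ l ∈ Finset.range N,
      z k * z l * ((G ((k : ℤ) + 1) ((l : ℤ) + 1) - G ((k : ℤ) + 1) (-((l : ℤ) + 1))) / 2)) :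
    WeilSemilocalPositivityOn {2} b :=
  weilSemilocalPositivityOn_two_of_window_sum_chi_nonneg hb hb2 fun N c ↦ by
    rw [hG N c]
    exact sum_modes_re_conj_mul_nonneg_of_sectors G hrefl N (hev N) (hod N) c

end Summit.RiemannHypothesis.RiemannHypothesis.Theorems.WeilFormatC

end
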